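import Literature.MathematicalPhysics.QuantumLattice.AnisotropicHeisenbergNeelOrder
import Literature.MathematicalPhysics.QuantumLattice.AnisotropicXYUnconditionalLongRangeOrder
import Literature.Probability.LatticeModels.BrillouinRiemannSumTwoVolume
import HarnessLib

/-!
# Néel order of the layered spin-`S` Heisenberg antiferromagnet for large spin, unconditionally:
# the two-sum-rule integral at `(t, μ) = (1, 0)` is below `√3 (I_K + 1) < 3`

Topic `MathematicalPhysics/QuantumLattice`; closes the certificate hypothesis of
`heisAniso_neelLRO_of_integral_dirCertificate` (`AnisotropicHeisenbergNeelOrder.lean`) with the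
simplest multipliers `t = 1`, `μ = 0` (the total sum rule (2) alone, Dyson–Lieb–Simon's original
argument) by an ANALYTIC bound on the integral, for `d = 3` and every coupling vector `K > 0` with
`2Kᵢ ≤ ΣⱼKⱼ` (the layered couplings `(1, 1, r)`, `0 < r ≤ 2`):

* `heisAnisoKlsIntegrand_one_zero_le` — pointwise,
  `G^K_{1,0}(p) = [ΣᵢKᵢ(1 + cos pᵢ)/ΣᵢKᵢ(1 - cos pᵢ)]^{1/2} ≤ √3 · (F_K(p) + 1)`, where
  `F_K = {ΣᵢKᵢcos pᵢ}₊ (2/(κ E^K_p))^{1/2}` is the anisotropic Kennedy–Lieb–Shastry integrand of the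
  XY chain (`anisoKlsIntegrand`): where `C = ΣKᵢcos pᵢ ≥ κ/2` one has `(κ + C)κ ≤ 6C²`, elsewhere
  `E^K = κ - C > κ/2` and `G² < 3`;
* `heisAnisoKlsIntegral_one_zero_le` — `𝓘^K_{1,0} ≤ √3 (I_K + 1)` (`d ≥ 3`, `K > 0`), whence with
  the tree's `anisoKlsIntegral_le_two` / `anisoKlsIntegral_two_lt` (`I_K ≤ I_{(1,1)} < √2/2`):
  **`𝓘^K_{1,0} < 3`** for `d = 3`, `2Kᵢ ≤ ΣK` (`heisAnisoKlsIntegral_one_zero_lt_three`);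
* **`heisAniso_neelOrderParameter_ge_three`** — for such `K` and every spin `S = n/2`, along the
  even tori `(ℤ/2kℤ)³`:
  `liminf |Λ|⁻² Σ_{x,y} (-1)^{x+y} ⟨𝐒_x·𝐒_y⟩ ≥ S(S+1) - 9S/√2`,
  positive as soon as `S ≥ 11/2` (`layeredHeis_neelLRO_largeSpin`: the layered model `(1,1,r)`,
  `0 < r ≤ 2`, `n ≥ 11`) — Néel long-range order in the ground state with NO numerical input, the
  large-spin regime of [DysonLiebSimon1978] for direction-dependent couplings. (For `S = ½`,
  [KLS1988JSP]'s `r ≥ 0.16` needs the numerical evaluation of (6)–(9), left as the certificate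
  input of `layeredHeis_neelLRO_of_certificate`.)

No named fact is introduced; nothing numerical beyond rational arithmetic and the decimal
brackets `√2 < 1.4143`, `1.4142 < √2`, `√3 < 1.7321`.

## References

* [DysonLiebSimon1978] F. J. Dyson, E. H. Lieb, B. Simon, J. Stat. Phys. 18 (1978) 335–383,
  §6, Thm. 6.2 ("the nearest neighbor, simple cubic antiferromagnet has a phase transition at
  sufficiently low temperature if `ν ≥ 3`, `S = 1, 3/2, …`"; read in Lieb's Selecta, p. 172) — the
  large-spin regime; the present file is its ground-state, direction-dependent-coupling analogue
  with a crude explicit constant in place of the Watson integral `G₃(0) = 0.505`.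
* [KLS1988JSP] T. Kennedy, E. H. Lieb, B. S. Shastry, J. Stat. Phys. 53 (1988) 1019–1030, §3,
  eqs. (5)–(9).
-/

noncomputable section

open MeasureTheory Set Filter Topology Finset
open Literature.MathematicalPhysics.QuantumLattice Literature.Probability.LatticeModels
  Literature.MathematicalPhysics.QuantumFieldTheory.Balaban1983to89.Beta

namespace Literature.MathematicalPhysics.QuantumLattice

variable {d : ℕ}

/-! ### The pointwise comparison with the XY integrand -/

/-- `G^K_{1,0}(p) = [ΣᵢKᵢ(1 + cos pᵢ)/E^K_p]^{1/2}` (the kernel of `(t, μ) = (1, 0)` is `≡ 1`).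
[cite: KLS1988JSP, eqs. (6)-(9)] -/
theorem heisAnisoKlsIntegrand_one_zero (K : Fin d → ℝ) (p : Fin d → ℝ) :
    heisAnisoKlsIntegrand K 1 0 p =
      Real.sqrt ((∑ i, K i + anisoCosSum K p) / NVectorAniso.anisoDispersion K p) := by
  rw [heisAnisoKlsIntegrand]
  have h0 : ∑ i : Fin d, (0 : Fin d → ℝ) i * Real.cos (p i) = 0 :=
    sum_eq_zero fun i _ => by simp
  have hN : ∑ i, K i * (1 + Real.cos (p i)) = ∑ i, K i + anisoCosSum K p := by
    rw [anisoCosSum, ← sum_add_distrib]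
    exact sum_congr rfl fun i _ => by ring
  rw [h0, sub_zero, max_eq_left (zero_le_one' ℝ), one_mul, hN]

/-- `E^K_p = κ - C_K(p)`. [cite: KLS1988JSP, eq. (7)] -/
theorem anisoDispersion_eq_sub_anisoCosSum (K : Fin d → ℝ) (p : Fin d → ℝ) :
    NVectorAniso.anisoDispersion K p = ∑ i, K i - anisoCosSum K p := by
  rw [NVectorAniso.anisoDispersion, anisoCosSum, ← sum_sub_distrib]
  exact sum_congr rfl fun i _ => by ring

/-- `|C_K(p)| ≤ κ` for `K ≥ 0`: `-κ ≤ ΣKᵢcos pᵢ ≤ κ`. [cite: KLS1988PRL, eq. (8)] -/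
theorem abs_anisoCosSum_le {K : Fin d → ℝ} (hK : ∀ i, 0 ≤ K i) (p : Fin d → ℝ) :
    |anisoCosSum K p| ≤ ∑ i, K i := by
  rw [anisoCosSum]
  refine (abs_sum_le_sum_abs _ _).trans (sum_le_sum fun i _ => ?_)
  rw [abs_mul, abs_of_nonneg (hK i)]
  exact mul_le_of_le_one_right (hK i) (Real.abs_cos_le_one _)

/-- **The pointwise comparison** `G^K_{1,0}(p) ≤ √3 (F_K(p) + 1)` (`K ≥ 0`): on
`{C_K ≥ κ/2}` from `(κ + C)κ ≤ 6C²`, i.e. `G² ≤ 3F²`; on `{C_K < κ/2}` from `E^K = κ - C > κ/2`,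
`G² < 3`. [cite: DysonLiebSimon1978, Thm. 6.2] -/
theorem heisAnisoKlsIntegrand_one_zero_le {K : Fin d → ℝ} (hK : ∀ i, 0 ≤ K i) (p : Fin d → ℝ) :
    heisAnisoKlsIntegrand K 1 0 p ≤ Real.sqrt 3 * (anisoKlsIntegrand K p + 1) := by
  have hCabs := abs_anisoCosSum_le hK p
  rw [abs_le] at hCabs
  obtain ⟨hC1, hC2⟩ := hCabs
  have hF0 : 0 ≤ anisoKlsIntegrand K p := anisoKlsIntegrand_nonneg K p
  have h3 : 0 ≤ Real.sqrt 3 := Real.sqrt_nonneg 3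
  have hFdef : anisoKlsIntegrand K p = max (anisoCosSum K p) 0 *
      Real.sqrt (2 / ((∑ i, K i) * NVectorAniso.anisoDispersion K p)) := rfl
  rw [anisoDispersion_eq_sub_anisoCosSum] at hFdef
  rw [heisAnisoKlsIntegrand_one_zero, anisoDispersion_eq_sub_anisoCosSum]
  set κ : ℝ := ∑ i, K i
  set C : ℝ := anisoCosSum K p
  set F : ℝ := anisoKlsIntegrand K p
  have hκ0 : 0 ≤ κ := sum_nonneg fun i _ => hK i
  by_cases hhalf : κ ≤ 2 * C
  · -- `C ≥ κ/2`: `G² ≤ 3 F²`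
    have hC0 : 0 ≤ C := by linarith
    have hF : F = C * Real.sqrt (2 / (κ * (κ - C))) := by rw [hFdef, max_eq_left hC0]
    have h2nn : 0 ≤ 2 / (κ * (κ - C)) := div_nonneg (by norm_num) (mul_nonneg hκ0 (by linarith))
    have hsq : (κ + C) / (κ - C) ≤ 3 * F ^ 2 := by
      rw [hF, mul_pow, Real.sq_sqrt h2nn]
      rcases eq_or_lt_of_le hκ0 with hκz | hκpos
      · -- `κ = 0`: then `C = 0` and both sides vanish (`x/0 = 0`)
        have hCz : C = 0 := by linarith
        rw [← hκz, hCz]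
        simp
      rcases eq_or_lt_of_le hC2 with hCκ | hClt
      · -- `C = κ`: `E^K = 0`, both sides vanish
        rw [hCκ, sub_self]
        simp
      have hEpos : 0 < κ - C := by linarith
      have hκne : κ ≠ 0 := hκpos.ne'
      have hEne : κ - C ≠ 0 := hEpos.ne'
      rw [div_le_iff₀ hEpos, show 3 * (C ^ 2 * (2 / (κ * (κ - C)))) * (κ - C) =
        6 * C ^ 2 / κ by field_simp; ring, le_div_iff₀ hκpos]
      nlinarith [mul_nonneg (by linarith : 0 ≤ 2 * C - κ) (by linarith : 0 ≤ 3 * C + κ)]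
    calc Real.sqrt ((κ + C) / (κ - C)) ≤ Real.sqrt (3 * F ^ 2) := Real.sqrt_le_sqrt hsq
      _ = Real.sqrt 3 * F := by
          rw [Real.sqrt_mul (show (0 : ℝ) ≤ 3 by norm_num), Real.sqrt_sq hF0]
      _ ≤ Real.sqrt 3 * (F + 1) := mul_le_mul_of_nonneg_left (by linarith) h3
  · -- `C < κ/2`: `E^K = κ - C > κ/2 ≥ 0` and `(κ + C)/(κ - C) ≤ 3`
    rw [not_le] at hhalf
    have hEpos : 0 < κ - C := by linarith
    have hsq : (κ + C) / (κ - C) ≤ 3 := by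
      rw [div_le_iff₀ hEpos]
      linarith
    calc Real.sqrt ((κ + C) / (κ - C)) ≤ Real.sqrt 3 := Real.sqrt_le_sqrt hsq
      _ ≤ Real.sqrt 3 * (F + 1) := le_mul_of_one_le_right h3 (by linarith)

/-! ### The integral bound -/

/-- `F_K` is integrable on the Brillouin zone (`d ≥ 3`, `K > 0`). [cite: KLS1988PRL, eq. (8)] -/
theorem integrableOn_anisoKlsIntegrand (hd3 : 3 ≤ d) {K : Fin d → ℝ} (hK : ∀ i, 0 < K i) :
    IntegrableOn (anisoKlsIntegrand K) (brillouin d) volume := by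
  have hd : 1 ≤ d := by omega
  obtain ⟨i₀, -, hi₀⟩ := exists_min_image univ K ⟨⟨0, by omega⟩, mem_univ _⟩
  have hm : 0 < K i₀ := hK i₀
  have hmK : ∀ i, K i₀ ≤ K i := fun i => hi₀ i (mem_univ i)
  have hG : ContinuousOn (anisoKlsIntegrand K) (brillouin d \ {0}) := by
    intro p hp
    have hp0 : p ≠ 0 := fun h => hp.2 h
    have hE : 0 < dispersion p := dispersion_pos_of_mem_brillouin hp.1 hp0
    have hEK : 0 < NVectorAniso.anisoDispersion K p :=
      lt_of_lt_of_le (by positivity) (mul_dispersion_le_anisoDispersion hmK p)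
    exact (continuousAt_anisoKlsIntegrand hd hK hEK).continuousWithinAt
  refine PuncturedRiemannSum.integrableOn_brillouin_of_norm_le_inv_dispersion hd3 hG (C₀ := 1 / 2)
    (C₁ := (∑ i, K i) / K i₀) fun p hp hp0 => ?_
  rw [Real.norm_of_nonneg (anisoKlsIntegrand_nonneg K p)]
  exact anisoKlsIntegrand_le_inv_dispersion hd hm hmK hp hp0

/-- **`𝓘^K_{1,0} ≤ √3 (I_K + 1)`** for `d ≥ 3`, `K > 0` (integrate the pointwise comparison over
`[-π,π]^d`, `|[-π,π]^d| = (2π)^d`). [cite: DysonLiebSimon1978, Thm. 6.2] -/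
theorem heisAnisoKlsIntegral_one_zero_le (hd3 : 3 ≤ d) {K : Fin d → ℝ} (hK : ∀ i, 0 < K i) :
    heisAnisoKlsIntegral K 1 0 ≤ Real.sqrt 3 * (anisoKlsIntegral K + 1) := by
  have h2π : (0 : ℝ) < (2 * Real.pi) ^ d := by positivity
  have hvol : (volume : Measure (Fin d → ℝ)).real (brillouin d) = (2 * Real.pi) ^ d :=
    volume_real_brillouin
  have hGi := integrableOn_heisAnisoKlsIntegrand hd3 hK 1 0
  have hFi := integrableOn_anisoKlsIntegrand hd3 hK
  have h2π' : (2 * Real.pi) ^ d ≠ 0 := h2π.ne'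
  have h1i : IntegrableOn (fun _ : Fin d → ℝ => (1 : ℝ)) (brillouin d) volume :=
    integrableOn_const (isCompact_brillouin d).measure_lt_top.ne
  have hRi : IntegrableOn (fun p => Real.sqrt 3 * (anisoKlsIntegrand K p + 1)) (brillouin d) volume :=
    (hFi.add h1i).const_mul (Real.sqrt 3)
  have hmono : ∫ p in brillouin d, heisAnisoKlsIntegrand K 1 0 p ≤
      ∫ p in brillouin d, Real.sqrt 3 * (anisoKlsIntegrand K p + 1) :=
    setIntegral_mono hGi hRi fun p => heisAnisoKlsIntegrand_one_zero_le (fun i => (hK i).le) p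
  have hR : ∫ p in brillouin d, Real.sqrt 3 * (anisoKlsIntegrand K p + 1) =
      Real.sqrt 3 * ((∫ p in brillouin d, anisoKlsIntegrand K p) + (2 * Real.pi) ^ d) := by
    rw [integral_const_mul, integral_add hFi h1i, setIntegral_const, hvol, smul_eq_mul, mul_one]
  rw [heisAnisoKlsIntegral, anisoKlsIntegral, div_le_iff₀ h2π]
  calc ∫ p in brillouin d, heisAnisoKlsIntegrand K 1 0 p
      ≤ Real.sqrt 3 * ((∫ p in brillouin d, anisoKlsIntegrand K p) + (2 * Real.pi) ^ d) :=
        hmono.trans_eq hR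
    _ = Real.sqrt 3 * ((∫ p in brillouin d, anisoKlsIntegrand K p) / (2 * Real.pi) ^ d + 1) *
        (2 * Real.pi) ^ d := by
        rw [div_add_one h2π', mul_assoc, div_mul_cancel₀ _ h2π']

/-- **`𝓘^K_{1,0} < 3` in three dimensions** for `K > 0` with `2Kᵢ ≤ ΣⱼKⱼ` (in particular
`K = (1, 1, r)`, `0 < r ≤ 2`): `√3 (I_K + 1) ≤ √3 (I_{(1,1)} + 1) < √3 (1 + √2/2) < 3`
(`anisoKlsIntegral_three_le_two`, `anisoKlsIntegral_two_lt`). [cite: KLS1988JSP, §3] -/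
theorem heisAnisoKlsIntegral_one_zero_lt_three {K : Fin 3 → ℝ} (hK : ∀ i, 0 < K i)
    (h2 : ∀ i, 2 * K i ≤ ∑ j, K j) : heisAnisoKlsIntegral K 1 0 < 3 := by
  have hκ : 0 < ∑ i, K i :=
    lt_of_lt_of_le (hK 0) (single_le_sum (fun j _ => (hK j).le) (mem_univ 0))
  have hI := (anisoKlsIntegral_three_le_two hκ h2).trans anisoKlsIntegral_two_lt.le
  have h3 : 0 ≤ Real.sqrt 3 := Real.sqrt_nonneg 3
  have hs2 : Real.sqrt 2 < 1.4143 := by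
    rw [Real.sqrt_lt' (by norm_num)]; norm_num
  have hs3 : Real.sqrt 3 < 1.7321 := by
    rw [Real.sqrt_lt' (by norm_num)]; norm_num
  calc heisAnisoKlsIntegral K 1 0 ≤ Real.sqrt 3 * (anisoKlsIntegral K + 1) :=
        heisAnisoKlsIntegral_one_zero_le (le_refl 3) hK
    _ ≤ Real.sqrt 3 * (Real.sqrt 2 / 2 + 1) := mul_le_mul_of_nonneg_left (by linarith) h3
    _ < 3 := by
        nlinarith [mul_nonneg (sub_nonneg.2 hs3.le) (Real.sqrt_nonneg 2), hs2, hs3]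

/-! ### Néel order for large spin -/

/-- `√(S²/2) = S/√2 ≥ 0`-type step: `√(x/2) ≤ S/√2` for `x ≤ S²`, `S ≥ 0`.
[cite: DysonLiebSimon1978, Thm. 6.2] -/
theorem Real.sqrt_div_two_le {x S : ℝ} (hS : 0 ≤ S) (hx : x ≤ S ^ 2) :
    Real.sqrt (x / 2) ≤ S / Real.sqrt 2 := by
  have h2 : 0 < Real.sqrt 2 := Real.sqrt_pos.2 (by norm_num)
  have hsq : (S / Real.sqrt 2) ^ 2 = S ^ 2 / 2 := by
    rw [div_pow, Real.sq_sqrt (by norm_num : (0 : ℝ) ≤ 2)]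
  calc Real.sqrt (x / 2) ≤ Real.sqrt (S ^ 2 / 2) := Real.sqrt_le_sqrt (by linarith)
    _ = S / Real.sqrt 2 := by rw [← hsq, Real.sqrt_sq (div_nonneg hS h2.le)]

/-- **Néel order of the antiferromagnet with direction-dependent couplings for large spin**
(`d = 3`, `K > 0`, `2Kᵢ ≤ ΣK`): along the even tori `(ℤ/2kℤ)³`, for every spin `S = n/2`,
`liminf_k |Λ_k|⁻² Σ_{x,y} (-1)^{x+y} Σ_α G^α_K(x,y) ≥ S(S+1) - 9S/√2`
— the two-sum-rule bound with `(t, μ) = (1, 0)`, `W̄ = 3` and the worst case `-ε_{i₀} ≤ S²` of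
(T); Dyson–Lieb–Simon's large-spin Néel order, here for direction-dependent couplings and with an
explicit (crude) constant. [cite: DysonLiebSimon1978, Thm. 6.2] [cite: KLS1988JSP, §3] -/
theorem heisAniso_neelOrderParameter_ge_three {K : Fin 3 → ℝ} (hK : ∀ i, 0 < K i)
    (h2 : ∀ i, 2 * K i ≤ ∑ j, K j) (n : ℕ) :
    (n : ℝ) / 2 * ((n : ℝ) / 2 + 1) - 9 * ((n : ℝ) / 2) / Real.sqrt 2 ≤
      liminf (fun k : ℕ =>
        (∑ x : TorusSite 3 (2 * k + 2), ∑ y : TorusSite 3 (2 * k + 2),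
          (-1 : ℝ) ^ (∑ i, (x i).val) * (-1) ^ (∑ i, (y i).val) *
            ∑ α : Fin 3, heisAnisoGroundCorr α (2 * k + 2) n K x y) /
          ((2 * k + 2 : ℕ) : ℝ) ^ (2 * 3)) atTop := by
  obtain ⟨i₀, -, hi₀⟩ := exists_max_image univ K ⟨0, mem_univ _⟩
  have hmax : ∀ i, K i ≤ K i₀ := fun i => hi₀ i (mem_univ i)
  have hS0 : 0 ≤ (n : ℝ) / 2 := by positivity
  have hI : heisAnisoKlsIntegral K 1 0 < 3 := heisAnisoKlsIntegral_one_zero_lt_three hK h2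
  have h := heisAniso_neelLRO_of_integral_dirCertificate (n := n) (le_refl 3) hK hmax
    (Finset.univ : Finset Unit) (fun _ => (1 : ℝ)) (fun _ => (0 : Fin 3 → ℝ)) (fun _ => (3 : ℝ))
    (fun _ _ => by simp) (fun _ _ => hI)
    (δ := (n : ℝ) / 2 * ((n : ℝ) / 2 + 1) / 3 - 3 * ((n : ℝ) / 2) / Real.sqrt 2)
    (fun ε _ _ _ _ hTb => ⟨(), mem_univ _, by
      have hx : -ε i₀ ≤ ((n : ℝ) / 2) ^ 2 := by linarith [hTb i₀]
      have hsq := Real.sqrt_div_two_le hS0 hx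
      simp only [Pi.zero_apply, zero_mul, sum_const_zero, sub_zero, mul_one, one_mul, add_zero]
      have h3 : Real.sqrt (-ε i₀ / 2) * 3 ≤ 3 * ((n : ℝ) / 2) / Real.sqrt 2 := by
        rw [mul_comm, mul_div_assoc]
        exact mul_le_mul_of_nonneg_left hsq (by norm_num)
      linarith [h3]⟩)
  have e3 : 3 * ((n : ℝ) / 2 * ((n : ℝ) / 2 + 1) / 3 - 3 * ((n : ℝ) / 2) / Real.sqrt 2) =
      (n : ℝ) / 2 * ((n : ℝ) / 2 + 1) - 9 * ((n : ℝ) / 2) / Real.sqrt 2 := by ring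
  rw [← e3]
  exact h

/-- **The layered model `K = (1, 1, r)`** (`0 < r ≤ 2`): for every spin `S = n/2`,
`liminf |Λ|⁻² Σ_{x,y}(-1)^{x+y}⟨𝐒_x·𝐒_y⟩ ≥ S(S+1) - 9S/√2` along the even tori `(ℤ/2kℤ)³`.
[cite: DysonLiebSimon1978, Thm. 6.2] [cite: KLS1988JSP, §3, eq. (5)] -/
theorem layeredHeis_neelOrderParameter_ge {r : ℝ} (hr0 : 0 < r) (hr2 : r ≤ 2) (n : ℕ) :
    (n : ℝ) / 2 * ((n : ℝ) / 2 + 1) - 9 * ((n : ℝ) / 2) / Real.sqrt 2 ≤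
      liminf (fun k : ℕ =>
        (∑ x : TorusSite 3 (2 * k + 2), ∑ y : TorusSite 3 (2 * k + 2),
          (-1 : ℝ) ^ (∑ i, (x i).val) * (-1) ^ (∑ i, (y i).val) *
            ∑ α : Fin 3, heisAnisoGroundCorr α (2 * k + 2) n ![(1 : ℝ), 1, r] x y) /
          ((2 * k + 2 : ℕ) : ℝ) ^ (2 * 3)) atTop := by
  have hsum : ∑ j, ![(1 : ℝ), 1, r] j = 2 + r := by
    rw [Fin.sum_univ_three]
    show (1 : ℝ) + 1 + r = 2 + r
    ring
  refine heisAniso_neelOrderParameter_ge_three (fun i => ?_) (fun i => ?_) n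
  · fin_cases i
    · show (0 : ℝ) < 1; norm_num
    · show (0 : ℝ) < 1; norm_num
    · show (0 : ℝ) < r; exact hr0
  · rw [hsum]
    fin_cases i
    · show 2 * (1 : ℝ) ≤ 2 + r; linarith
    · show 2 * (1 : ℝ) ≤ 2 + r; linarith
    · show 2 * r ≤ 2 + r; linarith

/-- **Néel long-range order of the layered spin-`S` antiferromagnet for `S ≥ 11/2`, every
`0 < r ≤ 2`, unconditionally**: the floor `S(S+1) - 9S/√2` is positive for `n = 2S ≥ 11`.
[cite: DysonLiebSimon1978, Thm. 6.2] [cite: KLS1988JSP, §3, eq. (5)] -/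
theorem layeredHeis_neelLRO_largeSpin {r : ℝ} (hr0 : 0 < r) (hr2 : r ≤ 2) {n : ℕ} (hn : 11 ≤ n) :
    0 < (n : ℝ) / 2 * ((n : ℝ) / 2 + 1) - 9 * ((n : ℝ) / 2) / Real.sqrt 2 ∧
      (n : ℝ) / 2 * ((n : ℝ) / 2 + 1) - 9 * ((n : ℝ) / 2) / Real.sqrt 2 ≤
        liminf (fun k : ℕ =>
          (∑ x : TorusSite 3 (2 * k + 2), ∑ y : TorusSite 3 (2 * k + 2),
            (-1 : ℝ) ^ (∑ i, (x i).val) * (-1) ^ (∑ i, (y i).val) *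
              ∑ α : Fin 3, heisAnisoGroundCorr α (2 * k + 2) n ![(1 : ℝ), 1, r] x y) /
            ((2 * k + 2 : ℕ) : ℝ) ^ (2 * 3)) atTop := by
  refine ⟨?_, layeredHeis_neelOrderParameter_ge hr0 hr2 n⟩
  have hn' : (11 : ℝ) ≤ n := by exact_mod_cast hn
  have h2 : 0 < Real.sqrt 2 := Real.sqrt_pos.2 (by norm_num)
  have hs2 : 1.4142 < Real.sqrt 2 := by
    rw [Real.lt_sqrt (by norm_num)]; norm_num
  -- `S(S+1) - 9S/√2 = S (S + 1 - 9/√2)` and `9/√2 < 6.37 ≤ S + 1` for `S ≥ 5.5`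
  have hkey : 9 / Real.sqrt 2 < (n : ℝ) / 2 + 1 := by
    rw [div_lt_iff₀ h2]
    nlinarith [mul_nonneg (by linarith : (0 : ℝ) ≤ (n : ℝ) / 2 + 1 - 6.5) (sub_nonneg.2 hs2.le)]
  have hS : (0 : ℝ) < (n : ℝ) / 2 := by positivity
  have e : (n : ℝ) / 2 * ((n : ℝ) / 2 + 1) - 9 * ((n : ℝ) / 2) / Real.sqrt 2 =
      (n : ℝ) / 2 * ((n : ℝ) / 2 + 1 - 9 / Real.sqrt 2) := by
    ring
  rw [e]
  exact mul_pos hS (by linarith)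

end Literature.MathematicalPhysics.QuantumLattice
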